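import Summits.QuantumFields.YangMills.Theorems.BalabanUVNodesN07SplitClauseRecordShearNearTop
import Summits.QuantumFields.YangMills.Theorems.BalabanUVNodesN07SplitClauseRecordShearAtCubeDomains
import Summits.QuantumFields.YangMills.Theorems.BalabanUVNodesK0S5MeetFamilyJunction
import HarnessLib

/-!
# N07 [B11] (= [15] = [Balaban1985Variational]) Sect. F, road of record R0′, S6 HEAD — **THE OUTWARD MEET EDITION, FILE C: THE (r2) RECORD DOOR AND THE (159)-ASSEMBLY AT
# PRINT's (150) FAMILY `D″ = cubeDomains ⊓ domainsOfSeq Ω`** (n07-e `OUTWARD-MEET-EDITION-SPEC.md` (E3) = «FILE 2∕3 meet twins»): g4's FILE 2 `…RecordShearAtCubeDomains` and FILE 3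
# `…HeadAtCubeDomains` at the levelwise MEET of the cube tower of the datum with the record's region sequence ([15] p. 301 (150) «Ω′_j = □_j (j<k), Ω′_k = □″_k = □_k ∩ Ω_k»), the
# window `π(□)` allowed to leave `Ω_{K−n}` into `Ω_{K−n−1}` (the OUTWARD boundary datum: cells of `□″_k^{(k)}` AND `□′_k^{(k−1)}` under the window) — keyed on FILE B's near-top
# record door and FILE A's near-top `H`-doors; the meet's admissibility `Adm22 D″ R (L·M_h)` stays a HYPOTHESIS here (n07-w6 `adm22_meet_domainsOfSeq_seqOfRecord` discharges it
# from the record in the knit, FILE D), the canonical level boxes and their three box-membership facts are DISCHARGED (g4 FILE 1, generic in the family)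

Cell `pub-ymgap`, width seat `pub-ymgap-dag-n07-w4` g5 (sub-target S6 = the HEAD; MODULE 57 default pen), CLAIM-1 path (2) ∕ INTENT-4 (cell bus).
`--kind proof --supports stmt-QuantumFields-27364 --as helper` (K1⁹ per dag-lead KEY MAP v2); count-neutral; def-free.
[15] = [Balaban1985Variational]; [6] = [Balaban1985RegularSpaces]; [4] = [Balaban1984PropagatorsII]; [3] = [Balaban1985Averaging].

WHAT IS PROVED (sorry-free; no definition; axioms standard; compositions BY NAME).
§1 ★ `inOm_pred_meet_of_mem_box` — the window over the meet's level `K − n − 1`: non-wrapping tower, `1 ≤ k`, `Ω` decreasing + saturated, and «`π(□) ⊆ Ω_{k−1}`» when `k ≥ 2`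
   (the HEAD's collar (144) «□̃ ⊂ Ω_{k−1}», n07-e 57a) ⇒ every point of `π(□)` is in `Ω′_{k−1} ⊇ Ω′_k` of `D″` (k0-s1-w3's `inOm_top_meet_of_mem_box` one level down, WITHOUT «□ ⊆ Ω_k»).
§2 ★★★ `localGaugeSplitOn_of_gauge152_recordShear_dominated_meetCube_box (F N)` — FILE 2 at `D″`: n07-w8's sign-free record door (FILE B's near-top edition) at
   `D″ := domainsMeet (cubeDomains (F.P K) a M ρ (K − n) hk) (domainsOfSeq Ω (K − n) hk)`, `Y := π '' box L a M (K − n)`, canonical weights and CANONICAL LEVEL BOXES of the cube tower,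
   with `IsLevWeight`, the near-top window, the three box-membership facts (FILE 1 `levelBoxes_of_Om_subset_cubeDomains`, the meet is levelwise inside the tower) and the widths
   DISCHARGED; `Adm22 D″ R (L·M_h)` a hypothesis.
§3 ★★★ `localGaugeSplitOn_head159_meetCube_box (F N)` — FILE 3 at `D″`: §2 with the two `H`-letters of (159) SUPPLIED at the same family ∕ window by FILE A's near-top doors —
   `A₂ := H_V B` with print's data shapes ((160) CENTRED at a window point on the near class «level `k`, or source block in the next cube» = `□″_k^{(k)} ∪ □′_k^{(k−1)}` + top cells,
   (155) UNIFORM `β₂(ρ + M)` on its `ρ`-far complement, k0-s1-w3 `hcollar_of_not_near`) and `A₃ := H_V B′` (uniform `s`); `H`-constants shared.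
HONEST SCOPE.  Count-neutral compositions; the meet's admissibility, the collar «π(□) ⊆ Ω_{k−1}», S3's gauge, the (159) objects and identity, `A₁`'s letters, the data sizes, the
Landau copy's rows, the thresholds are HYPOTHESES — displayed, not discharged; nothing of [15]∕[6]∕[4]∕[3] ANALYSIS asserted; `DatumGaugeSplitTopStepCore(G∕R)` ∕ `HalvingStepTop(Core)`
∕ `stub_prop8StepCoPG13` NOT discharged; K0⁷ ∕ K1⁹ NOT closed; N07 NOT discharged; counts unmoved (typed 28∕28 · discharged 5∕27); one finite 𝕋⁴ programme at fixed ε — the route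
closes the conditional finite-𝕋⁴ rung `BalabanLadder.UV` ONLY; the YM mass gap (Clay) is NOT proved by any of this; nothing continuum ∕ ℝ⁴ ∕ OS.  No `sorry` ∕ `def` ∕ `instance` ∕ `notation`.

RELATED IN THE TREE, NOT DUPLICATED: g4 FILE 2∕3 (the `cubeDomains` instances — interior datums); k0-s1-w3 `K0S5MeetFamilyJunction` ∕ `K0S5UniformDatumDoor` (`…meetCube_box` doors with
«π(□) ⊆ Ω_k» — datums whose box stays in `Ω_k`); FILE A∕B (CONSUMED).

References: [15] (144) p. 300, (147)–(152) p. 301, (155) p. 302, (157)–(159) pp. 302–303, (160)–(161) p. 303, (163)–(165) p. 304, (168) p. 304; [6] (1.131) pp. 98–99;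
[4] (2.1)–(2.4) p. 224, (2.60) p. 234, Cor. 2.8 (2.150)–(2.151) p. 249; [3] (85)–(88) p. 31.
-/

set_option autoImplicit false

noncomputable section
open scoped BigOperators Matrix.Norms.L2Operator

namespace Summit.QuantumFields.YangMills.BalabanUVNodes.N07SplitClauseHeadAtMeetCube

open Literature.MathematicalPhysics.QuantumFieldTheory.Balaban1983to89
open Literature.MathematicalPhysics.QuantumFieldTheory.Balaban1983to89.Node00
open Literature.MathematicalPhysics.QuantumFieldTheory.Balaban1983to89.B12RegularSpaces111 (gaugeU expI grad)
open B15Eq112TorusCover (cover)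
open B14DomainGeom (Pt)
open B5Eq117TorusCarriers (Mk)
open B5Eq118OneStroke (iterBlockOf)
open B5Prop12FieldsLattice (distSite)
open B8Eq131Cubes (sqLo sqHi box cube)
open B11Eq115Space (levOf)
open B6SectADomainsV1 (Domains)
open B6SectAOperatorsV1 (BondIdx)
open T4Continuum (T4Family)
open T4AxialGaugeSmallField (castSite)
open B16Sect1Backgrounds (toMS)
open GaugeField (gaugeAct)
open MatrixLog (mlog)
open Summit.QuantumFields.YangMills.Theorems.FlatCubeOpsText (Adm22 distBI)
open Summit.QuantumFields.YangMills.Theorems.K0FlatCubeOpsTextP (flatH IsLevWeight)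
open Summit.QuantumFields.YangMills.Theorems.HalvingQuarterCubeSeq (distBI_nonneg)
open Summit.QuantumFields.YangMills.Theorems.K0S5MeetFamilyJunction (meet_cube_domainsOfSeq_k)
open Summit.QuantumFields.YangMills.Theorems.K0S5CollarMeetFamily (hcollar_of_not_near)
open Summit.QuantumFields.YangMills.Theorems.K0S5NearCentredAnyLevel (near_of_centred_box_anyLevel)
open Summit.QuantumFields.YangMills.BalabanUVNodes.N07CubeDomainsAdm22 (inOm_top_cubeDomains_of_mem_box)
open Summit.QuantumFields.YangMills.BalabanUVNodes.N07HalvingStepTopOfLocalLetters (Letters10On)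
open Summit.QuantumFields.YangMills.BalabanUVNodes.N07LocalLettersSplitCore (LocalGaugeSplitOn)
open Summit.QuantumFields.YangMills.BalabanUVNodes.N07SplitClauseBoxesCubeDomains (levelBoxes_of_Om_subset_cubeDomains)
open Summit.QuantumFields.YangMills.BalabanUVNodes.N07SplitClauseRecordShearAtCubeDomains (width_mul_le_of_closedForm)
open Summit.QuantumFields.YangMills.BalabanUVNodes.N07SplitClauseRecordShearNearTop (localGaugeSplitOn_of_gauge152_recordShear_dominated_adm22_T4_nearTop)
open Summit.QuantumFields.YangMills.BalabanUVNodes.N07Letters10NearTopDoors (letters10On_HB_of_core_adm22_T4_nearClassW_nearTop)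

/-! ## §1  The window lies over the meet's level `K − n − 1` -/

/-- ★ **THE WINDOW LIES OVER `Ω′_{k−1}` OF THE MEET** (`hY` of the near-top doors): for a non-wrapping tower (`hinj`), `1 ≤ k`, a decreasing saturated sequence `Ω`, and a window box
whose cover lies in `Ω_{k−1}` whenever `k ≥ 2` (the HEAD's collar «□̃ ⊂ Ω_{k−1}», n07-e 57a; at `k = 1` the level-`0` region of `domainsOfSeq` is everything): every point of `π(□)` has
level `≥ k − 1` in `D″ = cubeDomains ⊓ domainsOfSeq Ω k` (the cube side by `inOm_top_cubeDomains_of_mem_box` + nesting, the record side by `inOm_domainsOfSeq_iff`).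
[cite: Balaban1985Variational, (144) p.300, (150) p.301; Balaban1984PropagatorsII, (2.1)–(2.2) p.224] -/
theorem inOm_pred_meet_of_mem_box {P : Params} {a : Pt P.d} {M ρ k : ℕ} {hk : k ≤ P.m + P.K}
    (Ω : ℕ → Set (Site P 0)) (hinj : Set.InjOn (cover P) (cube P.L a M ρ k 0)) (hk1 : 1 ≤ k)
    (hnest : ∀ i : ℕ, 1 ≤ i → i < k → Ω (i + 1) ⊆ Ω i)
    (hsat : ∀ (j : ℕ) (x x' : Site P 0), 1 ≤ j → j ≤ k → iterBlockOf j x = iterBlockOf j x' → x ∈ Ω j → x' ∈ Ω j)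
    (hbox' : 2 ≤ k → ∀ x ∈ box P.L a M k, cover P x ∈ Ω (k - 1)) :
    ∀ z ∈ cover P '' box P.L a M k, (domainsMeet (cubeDomains P a M ρ k hk) (domainsOfSeq Ω k hk)).InOm (k - 1) z := by
  rintro _ ⟨x, hx, rfl⟩
  show iterBlockOf (k - 1) (cover P x) ∈ (domainsMeet (cubeDomains P a M ρ k hk) (domainsOfSeq Ω k hk)).Om (k - 1)
  rw [mem_domainsMeet_Om]
  refine ⟨(cubeDomains P a M ρ k hk).inOm_of_le (Nat.sub_le k 1) (inOm_top_cubeDomains_of_mem_box hinj hk1 hx), ?_⟩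
  by_cases h2 : 2 ≤ k
  · exact (inOm_domainsOfSeq_iff Ω hk hnest hsat (by omega) (Nat.sub_le k 1) _).2 (hbox' h2 x hx)
  · have h0 : k - 1 = 0 := by omega
    rw [h0]
    exact (domainsOfSeq Ω k hk).inOm_zero _

/-! ## §2  FILE 2 at the meet: the sign-free (r2) record door -/

open scoped Classical in
/-- ★★★ **THE (r2) RECORD DOOR AT PRINT's (150) FAMILY AND THE HEAD's WINDOW, SIGN-FREE FAMILY** — g4 FILE 2's `localGaugeSplitOn_of_gauge152_recordShear_dominated_cubeDomains_box` at the
MEET `D″ := domainsMeet (cubeDomains (F.P K) a M ρ (K − n) hk) (domainsOfSeq Ω (K − n) hk)` (`Ω` decreasing and saturated — the record's `s.Ω`; `π(□) ⊆ Ω_{K−n−1}` if `K − n ≥ 2`; the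
window may leave `Ω_{K−n}`), via FILE B's near-top door: canonical weights, CANONICAL LEVEL BOXES of the cube tower, the three box-membership facts and the widths DISCHARGED (FILE 1, the
meet is levelwise inside the tower), `Adm22 D″ R (L·M_h)` a HYPOTHESIS; shift family any `λ` with `‖λ_j(y)‖ ≤ ‖log ĝ_j(y)⁻¹‖`; conclusion `LocalGaugeSplitOn (π '' □) η_{K−n} t (t₁ + (t₂ +
t_∂) + t₃) U` for every `t_∂ > 2CB₃·(4σ)`. [cite: Balaban1985Variational, (144) p.300, (150)–(152) p.301, (157)–(159) pp.302–303, (161) p.303, (164)–(165) p.304, (168) p.304; Balaban1985RegularSpaces, (1.131) pp.98–99; Balaban1984PropagatorsII, (2.1)–(2.4) p.224, (2.60) p.234, Cor. 2.8 (2.150)–(2.151) p.249; Balaban1985Averaging, (85)–(88) p.31] -/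
theorem localGaugeSplitOn_of_gauge152_recordShear_dominated_meetCube_box (F : T4Family) (N : ℕ) [NeZero N] :
    ∃ (Mh₀ R₀ : ℕ) (C δ₀ δ₁ B₃ : ℝ), 0 ≤ C ∧ 0 < δ₀ ∧ 0 < δ₁ ∧ 0 < B₃ ∧
    ∀ (n K : ℕ) (_ : 1 ≤ K - n) (_ : K - n + 1 ≤ F.m + K) (hk : K - n ≤ (F.P K).m + (F.P K).K)
      {Mh R a' : ℕ} (_ : Mh = F.L ^ a') (_ : Mh₀ ≤ Mh) (_ : R₀ ≤ R) (_ : a' + 3 ≤ F.m + n)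
      {a : Pt (F.P K).d} {M ρ : ℕ} (_ : F.L ≤ ρ) (_ : Set.InjOn (cover (F.P K)) (cube (F.P K).L a M ρ (K - n) 0))
      -- the record side of the meet: a decreasing, saturated sequence with the window inside `Ω_{K−n−1}` (when `K − n ≥ 2`), and the meet's admissibility
      (Ω : ℕ → Set (Site (F.P K) 0)) (_ : ∀ i : ℕ, 1 ≤ i → i < K - n → Ω (i + 1) ⊆ Ω i)
      (_ : ∀ (j : ℕ) (x x' : Site (F.P K) 0), 1 ≤ j → j ≤ K - n → iterBlockOf j x = iterBlockOf j x' → x ∈ Ω j → x' ∈ Ω j)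
      (_ : 2 ≤ K - n → ∀ x ∈ box (F.P K).L a M (K - n), cover (F.P K) x ∈ Ω (K - n - 1))
      (_ : Adm22 (domainsMeet (cubeDomains (F.P K) a M ρ (K - n) hk) (domainsOfSeq Ω (K - n) hk)) R (F.L * Mh))
      {HV : (BondIdx (domainsMeet (cubeDomains (F.P K) a M ρ (K - n) hk) (domainsOfSeq Ω (K - n) hk)) → MatA N) →ₗ[ℂ] (PBond (F.P K) 0 → MatA N)}
      (_ : ∀ (B : BondIdx (domainsMeet (cubeDomains (F.P K) a M ρ (K - n) hk) (domainsOfSeq Ω (K - n) hk)) → MatA N) (b : PBond (F.P K) 0),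
        HV B b = ∑ c, ((flatH (F.P K) (K - n) (domainsMeet (cubeDomains (F.P K) a M ρ (K - n) hk) (domainsOfSeq Ω (K - n) hk)) (Pi.single c 1) b : ℝ) : ℂ) • B c)
      -- the CANONICAL level boxes of the cube tower (four equation binders)
      {lo hi : ℕ → Pt (F.P K).d}
      (_ : lo 0 = fun i => ((F.P K).L : ℤ) * (sqLo (F.P K).L a ρ (K - n) 1 i - 1))
      (_ : hi 0 = fun i => ((F.P K).L : ℤ) * (sqHi (F.P K).L a M ρ (K - n) 1 i + 1) + (((F.P K).L : ℤ) - 1))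
      (_ : ∀ j, 1 ≤ j → lo j = sqLo (F.P K).L a ρ (K - n) j - 1) (_ : ∀ j, 1 ≤ j → hi j = sqHi (F.P K).L a M ρ (K - n) j + 1)
      -- the (r1)+(r4) row's Landau copy, its gauge, the per-level bond letters on the canonical boxes, the uniform `σ` against the closed-form widths
      (uL : GaugeTransf (F.P K) 0 (SU N)) (U₁ : GaugeField (F.P K) 0 (SU N)) (v av : ℕ → ℝ) {σ : ℝ}
      (_ : ∀ j, 0 ≤ v j) (_ : ∀ j, 0 ≤ av j) (_ : σ ≤ 1 / 2)
      (_ : ∀ j ≤ K - n, (((F.P K).d * ((M + 4 * ρ + 3) * (F.P K).L ^ ((K - n) - j)) : ℕ) : ℝ) * (v j + av j) ≤ σ)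
      (_ : ∀ j ≤ K - n, ∀ c : PBond (F.P K) j, c.src ∈ (castSite '' Set.Icc (lo j) (hi j) : Set (Site (F.P K) j)) →
        c.tgt ∈ (castSite '' Set.Icc (lo j) (hi j) : Set (Site (F.P K) j)) → dist1 (Averaging.iter (avOfRecord F N K) j (gaugeAct uL U₁) c) ≤ v j)
      (_ : ∀ j ≤ K - n, ∀ c : PBond (F.P K) j, c.src ∈ (castSite '' Set.Icc (lo j) (hi j) : Set (Site (F.P K) j)) →
        c.tgt ∈ (castSite '' Set.Icc (lo j) (hi j) : Set (Site (F.P K) j)) → dist1 (Averaging.iter (avOfRecord F N K) j U₁ c) ≤ av j)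
      -- the shift family, DOMINATED by the (r1) letter family, and its datum
      (lam : (j : ℕ) → Site (F.P K) j → MatA N)
      (_ : ∀ (j : ℕ) (y : Site (F.P K) j), ‖lam j y‖ ≤ ‖mlog (((((toMS uL j (castSite (lo j)))⁻¹ * toMS uL j y)⁻¹ : SU N)) : MatA N)‖)
      {X : BondIdx (domainsMeet (cubeDomains (F.P K) a M ρ (K - n) hk) (domainsOfSeq Ω (K - n) hk)) → MatA N}
      (_ : ∀ c : BondIdx (domainsMeet (cubeDomains (F.P K) a M ρ (K - n) hk) (domainsOfSeq Ω (K - n) hk)),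
        X c = LatticeFieldCalculus.grad (((F.P K).L : ℝ) ^ (K - n) / ((F.P K).L : ℝ) ^ (c.1.1 : ℕ)) (lam c.1.1) c.1.2)
      -- S3's gauge of `U` on the window and the (159)-splitting of `A − H_V X`
      {U : GaugeField (F.P K) 0 (SU N)} (u : GaugeTransf (F.P K) 0 (SU N)) {A A₁ A₂ A₃ : PBond (F.P K) 0 → MatA N} {t t₁ t₂ t₃ : ℝ}
      (_ : ∀ b ∈ (Sect2.regionOfSet (F.P K) (cover (F.P K) '' box (F.P K).L a M (K - n))).bonds,
        gaugeU (fun x => ιSU N (u x)) (fun b' => ιSU N (U b')) b = expI ((F.P K).eta (K - n)) (A b))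
      (_ : ∀ b ∈ (Sect2.regionOfSet (F.P K) (cover (F.P K) '' box (F.P K).L a M (K - n))).bonds, ‖A b‖ < t)
      (_ : ∀ q ∈ (Sect2.regionOfSet (F.P K) (cover (F.P K) '' box (F.P K).L a M (K - n))).dpairs,
        ‖grad ((F.P K).eta (K - n)) q.2.1 (fun y => A ⟨y, q.2.2⟩) q.1‖ < t)
      (_ : ∀ b, A b - HV X b = A₁ b + A₂ b - A₃ b)
      (_ : Letters10On (cover (F.P K) '' box (F.P K).L a M (K - n)) ((F.P K).eta (K - n)) t₁ A₁)
      (_ : Letters10On (cover (F.P K) '' box (F.P K).L a M (K - n)) ((F.P K).eta (K - n)) t₂ A₂)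
      (_ : Letters10On (cover (F.P K) '' box (F.P K).L a M (K - n)) ((F.P K).eta (K - n)) t₃ A₃)
      {tD : ℝ} (_ : 2 * C * B₃ * (4 * σ) < tD),
      LocalGaugeSplitOn (cover (F.P K) '' box (F.P K).L a M (K - n)) ((F.P K).eta (K - n)) t (t₁ + (t₂ + tD) + t₃) U := by
  obtain ⟨Mh₀, R₀, C, δ₀, δ₁, B₃, hC, hδ₀, hδ₁, hB₃, hmain⟩ := localGaugeSplitOn_of_gauge152_recordShear_dominated_adm22_T4_nearTop F N
  refine ⟨Mh₀, R₀, C, δ₀, δ₁, B₃, hC, hδ₀, hδ₁, hB₃, ?_⟩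
  intro n K hk1 hk' hk Mh R a' hMha hMh hR hsize a M ρ hLρ hinj Ω hnest hsat hbox' hAdm HV hHV lo hi hlo0 hhi0 hloj hhij uL U₁ v av σ hv0 ha0 hσ hDσ hv hav
    lam hlam X hX U u A A₁ A₂ A₃ t t₁ t₂ t₃ he hA hdA h159 h₁ h₂ h₃ tD htD
  have hLP : (F.P K).L = F.L := rfl
  have hLρ' : (F.P K).L ≤ ρ := by rw [hLP]; exact hLρ
  -- the family's height, the canonical level weights, the near-top window (§1)
  have hDk : (domainsMeet (cubeDomains (F.P K) a M ρ (K - n) hk) (domainsOfSeq Ω (K - n) hk)).k = K - n := meet_cube_domainsOfSeq_k Ω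
  have hw : IsLevWeight (F.P K) (K - n) (domainsMeet (cubeDomains (F.P K) a M ρ (K - n) hk) (domainsOfSeq Ω (K - n) hk))
      (fun m b => (((F.P K).L : ℝ) ^ levOf (fun j => {x : Site (F.P K) 0 | (domainsMeet (cubeDomains (F.P K) a M ρ (K - n) hk) (domainsOfSeq Ω (K - n) hk)).InOm j x})
        (K - n) b.src * (((F.P K).L : ℝ)⁻¹) ^ (K - n)) ^ m) := fun _ _ => rfl
  have hY := inOm_pred_meet_of_mem_box (ρ := ρ) (hk := hk) Ω hinj hk1 hnest hsat hbox'
  -- the three box-membership facts of the canonical boxes for the meet (levelwise inside the cube tower: FILE 1) and the widths binder from its closed form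
  obtain ⟨hboxO, hboxS, hbox0⟩ := levelBoxes_of_Om_subset_cubeDomains (P := F.P K) (a := a) (M := M) (hk := hk) hLρ'
    (domainsMeet (cubeDomains (F.P K) a M ρ (K - n) hk) (domainsOfSeq Ω (K - n) hk)) (fun j _ => domainsMeet_le_left _ _ j) hlo0 hhi0 hloj hhij
  have hDσ' := width_mul_le_of_closedForm (P := F.P K) hk1 hlo0 hhi0 hloj hhij hv0 ha0 hDσ
  exact hmain n K hk1 hk' hMha hMh hR hsize _ hDk hAdm _ hw hY hHV uL U₁ lo hi v av hv0 ha0 hσ hDσ' hv hav hboxO hboxS hbox0 lam hlam hX u he hA hdA h159 h₁ h₂ h₃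
    htD

/-! ## §3  FILE 3 at the meet: the (159)-assembly with the two `H`-letters supplied at the same family and window -/

open scoped Classical in
/-- ★★★ **THE (159)-ASSEMBLY AT PRINT's (150) FAMILY AND THE HEAD's WINDOW** — g4 FILE 3's `localGaugeSplitOn_head159_cubeDomains_box` at the MEET `D″`: §2's record door with
`A₂ := H_V B` (data in print's shapes: (160) CENTRED at a window point `x_c ∈ □` on the near class «top level, or source block in the next cube» — print's `□″_k^{(k)} ∪ □′_k^{(k−1)}` plus
the top cells —, (155) UNIFORM `β₂·(ρ + M)` on its complement, which is `ρ`-far: k0-s1-w3 `hcollar_of_not_near`) and `A₃ := H_V B′` (`‖B′ c‖ ≤ s`) supplied by FILE A's near-top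
`HB` door at the same family ∕ window, `H`-constants shared; displayed: the meet's admissibility, the collar «π(□) ⊆ Ω_{K−n−1}», `H_V`'s kernel formula, the data sizes, `s`, `A₁`'s
letters, S3's gauge and (152) letters, the identity `A − H_V X = A₁ + H_V B − H_V B′`, the Landau copy's rows, the thresholds.
[cite: Balaban1985Variational, (144) p.300, (147)–(152) p.301, (155) p.302, (157)–(159) pp.302–303, (160)–(161) p.303, (163)–(165) p.304, (168) p.304; Balaban1985RegularSpaces, (1.131) pp.98–99; Balaban1984PropagatorsII, (2.1)–(2.4) p.224, (2.60) p.234, Cor. 2.8 (2.150)–(2.151) p.249; Balaban1985Averaging, (85)–(88) p.31] -/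
theorem localGaugeSplitOn_head159_meetCube_box (F : T4Family) (N : ℕ) [NeZero N] :
    ∃ (Mh₀ R₀ : ℕ) (CS BS CH δH BH : ℝ), 0 ≤ CS ∧ 0 < BS ∧ 0 ≤ CH ∧ 0 < δH ∧ 0 < BH ∧
    ∀ (n K : ℕ) (_ : 1 ≤ K - n) (_ : K - n + 1 ≤ F.m + K) (hk : K - n ≤ (F.P K).m + (F.P K).K)
      {Mh R a' : ℕ} (_ : Mh = F.L ^ a') (_ : Mh₀ ≤ Mh) (_ : R₀ ≤ R) (_ : a' + 3 ≤ F.m + n)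
      {a : Pt (F.P K).d} {M ρ : ℕ} (_ : 1 ≤ M) (_ : F.L ≤ ρ) (_ : Set.InjOn (cover (F.P K)) (cube (F.P K).L a M ρ (K - n) 0))
      -- the record side of the meet: a decreasing, saturated sequence with the window inside `Ω_{K−n−1}` (when `K − n ≥ 2`), and the meet's admissibility
      (Ω : ℕ → Set (Site (F.P K) 0)) (_ : ∀ i : ℕ, 1 ≤ i → i < K - n → Ω (i + 1) ⊆ Ω i)
      (_ : ∀ (j : ℕ) (x x' : Site (F.P K) 0), 1 ≤ j → j ≤ K - n → iterBlockOf j x = iterBlockOf j x' → x ∈ Ω j → x' ∈ Ω j)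
      (_ : 2 ≤ K - n → ∀ x ∈ box (F.P K).L a M (K - n), cover (F.P K) x ∈ Ω (K - n - 1))
      (_ : Adm22 (domainsMeet (cubeDomains (F.P K) a M ρ (K - n) hk) (domainsOfSeq Ω (K - n) hk)) R (F.L * Mh))
      {HV : (BondIdx (domainsMeet (cubeDomains (F.P K) a M ρ (K - n) hk) (domainsOfSeq Ω (K - n) hk)) → MatA N) →ₗ[ℂ] (PBond (F.P K) 0 → MatA N)}
      (_ : ∀ (B : BondIdx (domainsMeet (cubeDomains (F.P K) a M ρ (K - n) hk) (domainsOfSeq Ω (K - n) hk)) → MatA N) (b : PBond (F.P K) 0),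
        HV B b = ∑ c, ((flatH (F.P K) (K - n) (domainsMeet (cubeDomains (F.P K) a M ρ (K - n) hk) (domainsOfSeq Ω (K - n) hk)) (Pi.single c 1) b : ℝ) : ℂ) • B c)
      -- the `HB` summand's datum in print's shapes: (160) centred at a window point on the near class, (155) uniform `β₂(ρ + M)` on the far class; the (163)-type smallness of `θ`
      {xc : Pt (F.P K).d} (_ : xc ∈ box (F.P K).L a M (K - n))
      {β₁ β₂ θ : ℝ} (_ : 0 ≤ β₁) (_ : 0 ≤ β₂) (_ : 8 * CH * BH * Real.exp (-(δH * (ρ : ℝ))) ≤ θ)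
      {B : BondIdx (domainsMeet (cubeDomains (F.P K) a M ρ (K - n) hk) (domainsOfSeq Ω (K - n) hk)) → MatA N}
      (_ : ∀ c : BondIdx (domainsMeet (cubeDomains (F.P K) a M ρ (K - n) hk) (domainsOfSeq Ω (K - n) hk)),
        ((c.1.1 : ℕ) = K - n ∨ blockOf c.1.2.src ∈ (cubeDomains (F.P K) a M ρ (K - n) hk).Om ((c.1.1 : ℕ) + 1)) →
          ‖B c‖ ≤ β₁ * (distSite (Mk (F.P K) (c.1.1 : ℕ)) c.1.2.src (iterBlockOf (c.1.1 : ℕ) (cover (F.P K) xc)) + 1))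
      (_ : ∀ c : BondIdx (domainsMeet (cubeDomains (F.P K) a M ρ (K - n) hk) (domainsOfSeq Ω (K - n) hk)),
        ¬ ((c.1.1 : ℕ) = K - n ∨ blockOf c.1.2.src ∈ (cubeDomains (F.P K) a M ρ (K - n) hk).Om ((c.1.1 : ℕ) + 1)) → ‖B c‖ ≤ β₂ * ((ρ : ℝ) + M))
      -- the third summand's datum, uniformly small
      {B' : BondIdx (domainsMeet (cubeDomains (F.P K) a M ρ (K - n) hk) (domainsOfSeq Ω (K - n) hk)) → MatA N} {s : ℝ} (_ : 0 ≤ s) (_ : ∀ c, ‖B' c‖ ≤ s)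
      -- the CANONICAL level boxes of the cube tower (four equation binders)
      {lo hi : ℕ → Pt (F.P K).d}
      (_ : lo 0 = fun i => ((F.P K).L : ℤ) * (sqLo (F.P K).L a ρ (K - n) 1 i - 1))
      (_ : hi 0 = fun i => ((F.P K).L : ℤ) * (sqHi (F.P K).L a M ρ (K - n) 1 i + 1) + (((F.P K).L : ℤ) - 1))
      (_ : ∀ j, 1 ≤ j → lo j = sqLo (F.P K).L a ρ (K - n) j - 1) (_ : ∀ j, 1 ≤ j → hi j = sqHi (F.P K).L a M ρ (K - n) j + 1)
      -- the (r1)+(r4) row's Landau copy, its gauge, the per-level bond letters on the canonical boxes, the uniform `σ` against the closed-form widths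
      (uL : GaugeTransf (F.P K) 0 (SU N)) (U₁ : GaugeField (F.P K) 0 (SU N)) (v av : ℕ → ℝ) {σ : ℝ}
      (_ : ∀ j, 0 ≤ v j) (_ : ∀ j, 0 ≤ av j) (_ : σ ≤ 1 / 2)
      (_ : ∀ j ≤ K - n, (((F.P K).d * ((M + 4 * ρ + 3) * (F.P K).L ^ ((K - n) - j)) : ℕ) : ℝ) * (v j + av j) ≤ σ)
      (_ : ∀ j ≤ K - n, ∀ c : PBond (F.P K) j, c.src ∈ (castSite '' Set.Icc (lo j) (hi j) : Set (Site (F.P K) j)) →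
        c.tgt ∈ (castSite '' Set.Icc (lo j) (hi j) : Set (Site (F.P K) j)) → dist1 (Averaging.iter (avOfRecord F N K) j (gaugeAct uL U₁) c) ≤ v j)
      (_ : ∀ j ≤ K - n, ∀ c : PBond (F.P K) j, c.src ∈ (castSite '' Set.Icc (lo j) (hi j) : Set (Site (F.P K) j)) →
        c.tgt ∈ (castSite '' Set.Icc (lo j) (hi j) : Set (Site (F.P K) j)) → dist1 (Averaging.iter (avOfRecord F N K) j U₁ c) ≤ av j)
      -- the shift family, dominated by the (r1) letter family, and its datum
      (lam : (j : ℕ) → Site (F.P K) j → MatA N)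
      (_ : ∀ (j : ℕ) (y : Site (F.P K) j), ‖lam j y‖ ≤ ‖mlog (((((toMS uL j (castSite (lo j)))⁻¹ * toMS uL j y)⁻¹ : SU N)) : MatA N)‖)
      {X : BondIdx (domainsMeet (cubeDomains (F.P K) a M ρ (K - n) hk) (domainsOfSeq Ω (K - n) hk)) → MatA N}
      (_ : ∀ c : BondIdx (domainsMeet (cubeDomains (F.P K) a M ρ (K - n) hk) (domainsOfSeq Ω (K - n) hk)),
        X c = LatticeFieldCalculus.grad (((F.P K).L : ℝ) ^ (K - n) / ((F.P K).L : ℝ) ^ (c.1.1 : ℕ)) (lam c.1.1) c.1.2)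
      -- S3's gauge of `U` on the window, the first summand with its letters, and the (159) identity
      {U : GaugeField (F.P K) 0 (SU N)} (u : GaugeTransf (F.P K) 0 (SU N)) {A A₁ : PBond (F.P K) 0 → MatA N} {t t₁ : ℝ}
      (_ : ∀ b ∈ (Sect2.regionOfSet (F.P K) (cover (F.P K) '' box (F.P K).L a M (K - n))).bonds,
        gaugeU (fun x => ιSU N (u x)) (fun b' => ιSU N (U b')) b = expI ((F.P K).eta (K - n)) (A b))
      (_ : ∀ b ∈ (Sect2.regionOfSet (F.P K) (cover (F.P K) '' box (F.P K).L a M (K - n))).bonds, ‖A b‖ < t)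
      (_ : ∀ q ∈ (Sect2.regionOfSet (F.P K) (cover (F.P K) '' box (F.P K).L a M (K - n))).dpairs,
        ‖grad ((F.P K).eta (K - n)) q.2.1 (fun y => A ⟨y, q.2.2⟩) q.1‖ < t)
      (_ : Letters10On (cover (F.P K) '' box (F.P K).L a M (K - n)) ((F.P K).eta (K - n)) t₁ A₁)
      (_ : ∀ b, A b - HV X b = A₁ b + HV B b - HV B' b)
      -- thresholds in the doors' currencies
      {t₂ t₃ tD : ℝ} (_ : 1 / 4 * (M : ℝ) * max (4 * CH * BH * β₁) (θ * β₂) < t₂) (_ : 2 * CH * BH * s < t₃) (_ : 2 * CS * BS * (4 * σ) < tD),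
      LocalGaugeSplitOn (cover (F.P K) '' box (F.P K).L a M (K - n)) ((F.P K).eta (K - n)) t (t₁ + (t₂ + tD) + t₃) U := by
  obtain ⟨MhS, RS, CS, δS₀, δS, BS, hCS, _, _, hBS, hshear⟩ := localGaugeSplitOn_of_gauge152_recordShear_dominated_meetCube_box F N
  obtain ⟨MhH, RH, CH, δH₀, δH, BH, hCH, _, hδH, hBH, hH⟩ := letters10On_HB_of_core_adm22_T4_nearClassW_nearTop F N
  refine ⟨max MhS MhH, max RS RH, CS, BS, CH, δH, BH, hCS, hBS, hCH, hδH, hBH, ?_⟩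
  intro n K hk1 hk' hk Mh R a' hMha hMh hR hsize a M ρ hM1 hLρ hinj Ω hnest hsat hbox' hAdm HV hHV xc hxc β₁ β₂ θ hβ₁ hβ₂ h163 B hX₁ hX₂ B' s hs hB'
    lo hi hlo0 hhi0 hloj hhij uL U₁ v av σ hv0 ha0 hσ hDσ hv hav lam hlam X hX U u A A₁ t t₁ he hA hdA h₁ h159 t₂ t₃ tD ht₂ ht₃ htD
  have hMhS : MhS ≤ Mh := (le_max_left _ _).trans hMh
  have hMhH : MhH ≤ Mh := (le_max_right _ _).trans hMh
  have hRS : RS ≤ R := (le_max_left _ _).trans hR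
  have hRH : RH ≤ R := (le_max_right _ _).trans hR
  have hMr : (1 : ℝ) ≤ M := by exact_mod_cast hM1
  have hM0 : (0 : ℝ) ≤ M := by linarith
  have hL1 : (1 : ℝ) ≤ ((F.P K).L : ℝ) := by exact_mod_cast (F.P K).L_pos
  -- the meet's height, the near-top window (§1), the far class's collar (k0-s1-w3)
  have hDk : (domainsMeet (cubeDomains (F.P K) a M ρ (K - n) hk) (domainsOfSeq Ω (K - n) hk)).k = K - n := meet_cube_domainsOfSeq_k Ω
  have hY := inOm_pred_meet_of_mem_box (ρ := ρ) (hk := hk) Ω hinj hk1 hnest hsat hbox'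
  have hcollar := hcollar_of_not_near (P := F.P K) (a := a) (M := M) (ρ := ρ) (hk := hk) hDk
  have hkK : (domainsMeet (cubeDomains (F.P K) a M ρ (K - n) hk) (domainsOfSeq Ω (K - n) hk)).k ≤ (F.P K).m + (F.P K).K := by rw [hDk]; exact hk
  have hw : IsLevWeight (F.P K) (K - n) (domainsMeet (cubeDomains (F.P K) a M ρ (K - n) hk) (domainsOfSeq Ω (K - n) hk))
      (fun m b => (((F.P K).L : ℝ) ^ levOf (fun j => {x : Site (F.P K) 0 | (domainsMeet (cubeDomains (F.P K) a M ρ (K - n) hk) (domainsOfSeq Ω (K - n) hk)).InOm j x})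
        (K - n) b.src * (((F.P K).L : ℝ)⁻¹) ^ (K - n)) ^ m) := fun _ _ => rfl
  -- the `HB` letter (A₂ := H_V B): (160) centred ⇒ the near-class hypothesis at every level (`C_d·M_Δ·ε₁ := β₁·M`), (155) uniform ⇒ the far one via the collar and `L^{k−j} ≥ 1`
  have hxc' : xc ∈ box (F.P K).L a M (domainsMeet (cubeDomains (F.P K) a M ρ (K - n) hk) (domainsOfSeq Ω (K - n) hk)).k := by rw [hDk]; exact hxc
  have hnear := near_of_centred_box_anyLevel (domainsMeet (cubeDomains (F.P K) a M ρ (K - n) hk) (domainsOfSeq Ω (K - n) hk)) (a := a) (M := M) hkK hM1 hxc' _ hβ₁ hX₁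
  have h₂ : Letters10On (cover (F.P K) '' box (F.P K).L a M (K - n)) ((F.P K).eta (K - n)) t₂ (HV B) := by
    refine hH n K hk1 hk' hMha hMhH hRH hsize _ hDk hAdm _ hw (Cd := 1) (MΔ := (M : ℝ)) (ε₁ := β₁) (θ := θ) (R' := (ρ : ℝ))
      (ε := fun _ => β₂) zero_le_one hM0 hβ₁ hβ₂ (fun _ _ => by linarith) (by simpa using h163) _ hY hcollar hHV
      (fun b hb c hc => ?_) (fun b hb c hc => ?_) (by simpa using ht₂)
    · have hb' : b.src ∈ cover (F.P K) '' box (F.P K).L a M (domainsMeet (cubeDomains (F.P K) a M ρ (K - n) hk) (domainsOfSeq Ω (K - n) hk)).k := by rw [hDk]; exact hb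
      have h := hnear b hb' c hc
      have hKk : (domainsMeet (cubeDomains (F.P K) a M ρ (K - n) hk) (domainsOfSeq Ω (K - n) hk)).k - (c.1.1 : ℕ) = (K - n) - (c.1.1 : ℕ) := by omega
      rw [hKk] at h
      calc ‖B c‖ ≤ β₁ * M * ((F.P K).L : ℝ) ^ ((K - n) - (c.1.1 : ℕ)) * (distBI _ b c + 1) := h
        _ = 1 * (M : ℝ) * β₁ * ((F.P K).L : ℝ) ^ ((K - n) - (c.1.1 : ℕ)) * (distBI _ b c + 1) := by ring
    · have hpow : (1 : ℝ) ≤ ((F.P K).L : ℝ) ^ ((K - n) - (c.1.1 : ℕ)) := one_le_pow₀ hL1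
      have hρd : (ρ : ℝ) ≤ distBI _ b c := hcollar b hb c hc
      have hd0 : (0 : ℝ) ≤ distBI (domainsMeet (cubeDomains (F.P K) a M ρ (K - n) hk) (domainsOfSeq Ω (K - n) hk)) b c := (Nat.cast_nonneg ρ).trans hρd
      calc ‖B c‖ ≤ β₂ * ((ρ : ℝ) + M) := hX₂ c hc
        _ ≤ β₂ * (M * (distBI _ b c + 1)) := mul_le_mul_of_nonneg_left (by nlinarith) hβ₂
        _ = β₂ * M * 1 * (distBI _ b c + 1) := by ring
        _ ≤ β₂ * M * ((F.P K).L : ℝ) ^ ((K - n) - (c.1.1 : ℕ)) * (distBI _ b c + 1) :=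
            mul_le_mul_of_nonneg_right (mul_le_mul_of_nonneg_left hpow (by positivity)) (by linarith)
        _ = 1 * (M : ℝ) * β₂ * ((F.P K).L : ℝ) ^ ((K - n) - (c.1.1 : ℕ)) * (distBI _ b c + 1) := by ring
  -- the uniform letter (A₃ := H_V B′), same `H`-constants: near class everything, `R′ = 0`, `θ := 8CB₃`, `C_d = M_Δ = 1`
  have h₃ : Letters10On (cover (F.P K) '' box (F.P K).L a M (K - n)) ((F.P K).eta (K - n)) t₃ (HV B') := by
    have h163' : 8 * (1 : ℝ) * CH * BH * Real.exp (-(δH * 0)) ≤ 8 * CH * BH := by simp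
    have hmax : 1 / 4 * (1 : ℝ) * max (4 * 1 * CH * BH * s) (8 * CH * BH * s) < t₃ := by
      have hCB : 0 ≤ CH * BH * s := by positivity
      rw [max_eq_right (by nlinarith)]
      linarith
    refine hH n K hk1 hk' hMha hMhH hRH hsize _ hDk hAdm _ hw (Cd := 1) (MΔ := 1) (ε₁ := s) (θ := 8 * CH * BH) (R' := 0) (ε := fun _ => s)
      zero_le_one zero_le_one hs hs (fun _ _ => by linarith) h163' (fun _ => True) hY (fun b _ c hc => absurd trivial hc) hHV
      (fun b _ c _ => ?_) (fun b _ c hc => absurd trivial hc) hmax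
    have hd := distBI_nonneg (domainsMeet (cubeDomains (F.P K) a M ρ (K - n) hk) (domainsOfSeq Ω (K - n) hk)) b c
    have hpow : (1 : ℝ) ≤ ((F.P K).L : ℝ) ^ ((K - n) - (c.1.1 : ℕ)) := one_le_pow₀ hL1
    calc ‖B' c‖ ≤ s := hB' c
      _ = s * 1 * 1 := by ring
      _ ≤ s * ((F.P K).L : ℝ) ^ ((K - n) - (c.1.1 : ℕ)) * (distBI _ b c + 1) :=
          mul_le_mul (mul_le_mul_of_nonneg_left hpow hs) (by linarith) zero_le_one (by positivity)
      _ = 1 * 1 * s * ((F.P K).L : ℝ) ^ ((K - n) - (c.1.1 : ℕ)) * (distBI _ b c + 1) := by ring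
  -- the shift side: §2 with `A₂ := H_V B`, `A₃ := H_V B′`
  exact hshear n K hk1 hk' hk hMha hMhS hRS hsize hLρ hinj Ω hnest hsat hbox' hAdm hHV hlo0 hhi0 hloj hhij uL U₁ v av hv0 ha0 hσ hDσ hv hav lam hlam hX u
    he hA hdA h159 h₁ h₂ h₃ htD

end Summit.QuantumFields.YangMills.BalabanUVNodes.N07SplitClauseHeadAtMeetCube

end
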